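import Literature.Analysis.FluidPDE.Tao2016AveragedNS.SplitCascadeRescaledExit
import Literature.Analysis.FluidPDE.Tao2016AveragedNS.SplitCascadeZeroScaleSetup
import Literature.Analysis.FluidPDE.Tao2016AveragedNS.SplitCascadeRescaledWindow
import Literature.Analysis.FluidPDE.TaoCascadeReducedClaimLinks
import HarnessLib

/-!
# The split Prop. 6.5: the standing context of §6.7 from the hypotheses, the bootstrap regime and the window

T. Tao, *Finite time blowup for an averaged three-dimensional Navier–Stokes equation*,
arXiv:1402.0290v3, §6.5 Lemma 6.9, §6.7.
HONEST FRAMING: statements about the SPLIT cascade model system; nothing here proves the split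
Prop. 6.5 and nothing here concerns the true Navier–Stokes equations.

Split counterpart of `TaoCascadeReducedClaimLinks.lean`, first half (`zeroScale_context`): the
standing context `ZeroScale.Context` of the ported §6.7 (`SplitCascadeZeroScaleSetup.lean`) from the
split hypotheses with error constant `C₁/2`, `GoodAt` on `[0, T]`, the bounds of Prop. 6.13
(`SmallModes`), the pointwise window certificate `|Z̃_{i,k}| ≤ ζ` (`k ∈ {-1,0,1}`, e.g. from
`SplitCascadeRescaledWindowCert.lean`) and the STRONG master smallness of `ζ` (that of `AsymWindow`),
which gives both the context's weak master smallness and the window structure `AsymWindow`.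
Lemma 6.9♯ bounds `Ẽ_k - ½(Σỹ² + ΣZ̃²)`; the asymmetry energy `½ΣZ̃² ≤ (3/2)ζ² ≤ C₁(1+ε₀)^{-n₀/2}` is
moved into the primary-modes constant: `C₅ = C₂(1+ε₀)²(cumEnergyConst ε₀ C₃ + 100) + C₁`.
(The second half of the tree file, `ReducedConclusion.of_nextState`, concerns symmetric amplitudes
only and is reused as is.)

## References

* T. Tao, arXiv:1402.0290v3, §6.5 Lemma 6.9, §6.7. [`Tao2016AveragedNS`]
-/

noncomputable section

open Set MeasureTheory intervalIntegral

namespace Literature.Analysis.FluidPDE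

namespace Tao2016AveragedNS

open TaoCascade
open TaoCascade.ZeroScale hiding Context Setting
open Literature.Analysis.ODE

section Context

variable {ε₀ K ε C₁ C₂ C₃ : ℝ} {n₀ N : ℤ} {ηp : ℤ → ℝ} {βp : ℕ → ℝ} {τ : ℤ → ℝ}
  {Y : Fin 4 → ℤ → ℝ → ℝ} {W : Fin 3 → ℤ → ℝ → ℝ} {F : ℤ → ℝ → ℝ}

/-- The weak master smallness from the strong one (`K⁵(1+ε₀)² ≥ 1`).
[cite: Tao2016AveragedNS, §6.7] -/
theorem asym_small_of_strong (hK : 1 ≤ K) (hε₀ : 0 ≤ ε₀) (hε : 0 < ε) {ζ B : ℝ}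
    (hs : 16 * (K ^ 5 * (1 + ε₀) ^ (2 : ℝ)) * ((ε ^ 2)⁻¹ + ε⁻¹ * K ^ 10 + K + 1) * ζ ^ 2 ≤ B) :
    16 * ((ε ^ 2)⁻¹ + ε⁻¹ * K ^ 10 + K + 1) * ζ ^ 2 ≤ B := by
  have hq2 : (1 : ℝ) ≤ (1 + ε₀) ^ (2 : ℝ) := Real.one_le_rpow (by linarith) (by norm_num)
  have hK5 : (1 : ℝ) ≤ K ^ 5 := one_le_pow₀ hK
  have hL : (1 : ℝ) ≤ K ^ 5 * (1 + ε₀) ^ (2 : ℝ) := one_le_mul_of_one_le_of_one_le hK5 hq2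
  have hK0 : 0 ≤ K := by linarith
  have hS : 0 ≤ 16 * ((ε ^ 2)⁻¹ + ε⁻¹ * K ^ 10 + K + 1) * ζ ^ 2 := by positivity
  have e : 16 * (K ^ 5 * (1 + ε₀) ^ (2 : ℝ)) * ((ε ^ 2)⁻¹ + ε⁻¹ * K ^ 10 + K + 1) * ζ ^ 2 =
      (K ^ 5 * (1 + ε₀) ^ (2 : ℝ)) * (16 * ((ε ^ 2)⁻¹ + ε⁻¹ * K ^ 10 + K + 1) * ζ ^ 2) := by ring
  have a1 := mul_le_mul_of_nonneg_right hL hS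
  rw [one_mul, ← e] at a1
  exact a1.trans hs

/-- `ζ² ≤ C₁(1+ε₀)^{-n₀/2}/32` from the weak master smallness. [cite: Tao2016AveragedNS, §6.7] -/
theorem sq_le_of_asym_small (hK : 0 ≤ K) (hε : 0 < ε) {ζ C₁ δ : ℝ}
    (hs : 16 * ((ε ^ 2)⁻¹ + ε⁻¹ * K ^ 10 + K + 1) * ζ ^ 2 ≤ C₁ / 2 * δ) :
    32 * ζ ^ 2 ≤ C₁ * δ := by
  have hz : 0 ≤ ζ ^ 2 := sq_nonneg _
  have hrest : 0 ≤ ((ε ^ 2)⁻¹ + ε⁻¹ * K ^ 10 + K) * ζ ^ 2 := by positivity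
  nlinarith

/-- **The standing context `ZeroScale.Context` of the ported §6.7 at a time `T`**, from the split
hypotheses with error constant `C₁/2`, `GoodAt` on `[0, T]` (`T ∈ [0, 100]`), the bounds of Prop. 6.13
on `b̃₁, c̃₁` (`SmallModes`, hypothesis), the pointwise window certificate `|Z̃_{i,k}(t)| ≤ ζ`
(`k ∈ {-1,0,1}`, `t ∈ [0,T]`) with the master smallness of `ζ`, and Lemma 6.9♯
(`energy_sub_half_sum`, which with `½ΣZ̃² ≤ (3/2)ζ² ≤ C₁(1+ε₀)^{-n₀/2}` gives `PrimaryModes` with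
`C₅ = C₂(1+ε₀)²(cumEnergyConst ε₀ C₃ + 100) + C₁`). [cite: Tao2016AveragedNS, §6.5 Lemma 6.9; §6.7] -/
theorem RescaledSplitHypotheses.zeroScale_context
    (h : RescaledSplitHypotheses (1 / 10 ^ 5 * Real.exp (-K ^ 10 / 2)) ε₀ K ε (C₁ / 2) C₂ C₃ n₀ N
      ηp βp τ Y W F)
    (hε₀ : 0 < ε₀) (hε₀1 : ε₀ < 1) (hK : 2 ≤ K) (hε : 0 < ε) (hε1 : ε ≤ 1) (hC₁ : 0 ≤ C₁)
    (hC₂ : 0 ≤ C₂) (hC₃ : 0 ≤ C₃) (hN : n₀ ≤ N) {T : ℝ} (hT : T ∈ Icc (0 : ℝ) 100)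
    (hgood : ∀ t ∈ Icc 0 T, GoodAt ε₀ K Y F t) {C₄ : ℝ} (hC₄ : 0 ≤ C₄)
    (hsmall : SmallModes K ε C₄ Y T) {ζ : ℝ}
    (hasym : ∀ t ∈ Icc 0 T, ∀ i : Fin 3, |W i (-1) t| ≤ ζ ∧ |W i 0 t| ≤ ζ ∧ |W i 1 t| ≤ ζ)
    (hζ : 16 * ((ε ^ 2)⁻¹ + ε⁻¹ * K ^ 10 + K + 1) * ζ ^ 2 ≤ C₁ / 2 * (1 + ε₀) ^ (-(n₀ : ℝ) / 2)) :
    ZeroScale.Context ε₀ K ε C₁ C₂ C₃ C₄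
      (C₂ * (1 + ε₀) ^ (2 : ℝ) * (cumEnergyConst ε₀ C₃ + 100) + C₁) n₀ N ηp βp τ Y W F T ζ := by
  have hq0 : (0 : ℝ) < 1 + ε₀ := by linarith
  have hδ0 : 0 < (1 + ε₀) ^ (-(n₀ : ℝ) / 2) := Real.rpow_pos_of_pos hq0 _
  have hC₅ : 0 ≤ C₂ * (1 + ε₀) ^ (2 : ℝ) * (cumEnergyConst ε₀ C₃ + 100) + C₁ := by
    have := cumEnergyConst_nonneg hε₀ hC₃
    positivity
  have h32 := sq_le_of_asym_small (by linarith : (0 : ℝ) ≤ K) hε hζ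
  -- Lemma 6.9♯ at `k = -1, 0` on `[0, T]`, with the asymmetry energy moved into the defect
  have hprim : ∀ t ∈ Icc 0 T, ∀ k : ℤ, (k = -1 ∨ k = 0) →
      F k t ≤ (1 / 2) * ∑ i, Y i k t ^ 2 +
        (C₂ * (1 + ε₀) ^ (2 : ℝ) * (cumEnergyConst ε₀ C₃ + 100) + C₁) * (1 + ε₀) ^ (-(n₀ : ℝ) / 2) := by
    intro t ht k hk
    have ht' : t ∈ Icc (0 : ℝ) 100 := ⟨ht.1, ht.2.trans hT.2⟩
    have hk' : k = -1 ∨ k = 0 ∨ k = 1 := by rcases hk with h1 | h1 <;> simp [h1]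
    have h69 := (h.energy_sub_half_sum hε₀ hε₀1 hK hC₂ hC₃ hN ht'
      (fun s hs => hgood s ⟨hs.1, hs.2.trans ht.2⟩) hk').2
    have e : primaryDefect ε₀ C₂ C₃ n₀ =
        C₂ * (1 + ε₀) ^ (2 : ℝ) * (cumEnergyConst ε₀ C₃ + 100) * (1 + ε₀) ^ (-(n₀ : ℝ) / 2) := by
      unfold primaryDefect; ring
    rw [e] at h69
    -- `Σ_i Z̃_{i,k}² ≤ 3 ζ²`
    have hWk : ∀ i : Fin 3, |W i k t| ≤ ζ := fun i => by
      rcases hk with rfl | rfl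
      · exact (hasym t ht i).1
      · exact (hasym t ht i).2.1
    have hW2 : ∀ i : Fin 3, W i k t ^ 2 ≤ ζ ^ 2 := fun i => by
      rw [← sq_abs]; exact pow_le_pow_left₀ (abs_nonneg _) (hWk i) 2
    have hsum : ∑ i, W i k t ^ 2 ≤ 3 * ζ ^ 2 := by
      rw [Fin.sum_univ_three]; linarith [hW2 0, hW2 1, hW2 2]
    nlinarith [hsum, h69, h32, hδ0.le, hC₁]
  exact
    { ε₀_pos := hε₀
      ε₀_lt := hε₀1
      K_ge := hK
      ε_pos := hε
      ε_le := hε1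
      C₁_nn := hC₁
      C₂_nn := hC₂
      C₃_nn := hC₃
      C₄_nn := hC₄
      C₅_nn := hC₅
      le_N := hN
      hyp := h
      T_nn := hT.1
      T_le := hT.2
      loc := hgood
      prim := ⟨fun t ht => hprim t ht (-1) (Or.inl rfl), fun t ht => hprim t ht 0 (Or.inr rfl)⟩
      small := hsmall
      asym := hasym
      asym_small := hζ }

/-- **The window structure `AsymWindow`** from the pointwise certificate and the strong master
smallness. [cite: Tao2016AveragedNS, §6.7] -/
theorem asymWindow_of_bounds {T ζ : ℝ}
    (hasym : ∀ t ∈ Icc 0 T, ∀ i : Fin 3, |W i (-1) t| ≤ ζ ∧ |W i 0 t| ≤ ζ ∧ |W i 1 t| ≤ ζ)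
    (hs : 16 * (K ^ 5 * (1 + ε₀) ^ (2 : ℝ)) * ((ε ^ 2)⁻¹ + ε⁻¹ * K ^ 10 + K + 1) * ζ ^ 2 ≤
      C₁ / 2 * (1 + ε₀) ^ (-(n₀ : ℝ) / 2)) :
    AsymWindow ε₀ K ε C₁ n₀ W T ζ where
  asym := hasym
  small := hs

/-- **Context and window together** from the strong master smallness (the form in which the ported
§6.6–6.7 files consume them). [cite: Tao2016AveragedNS, §6.7] -/
theorem RescaledSplitHypotheses.zeroScale_context_and_window
    (h : RescaledSplitHypotheses (1 / 10 ^ 5 * Real.exp (-K ^ 10 / 2)) ε₀ K ε (C₁ / 2) C₂ C₃ n₀ N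
      ηp βp τ Y W F)
    (hε₀ : 0 < ε₀) (hε₀1 : ε₀ < 1) (hK : 2 ≤ K) (hε : 0 < ε) (hε1 : ε ≤ 1) (hC₁ : 0 ≤ C₁)
    (hC₂ : 0 ≤ C₂) (hC₃ : 0 ≤ C₃) (hN : n₀ ≤ N) {T : ℝ} (hT : T ∈ Icc (0 : ℝ) 100)
    (hgood : ∀ t ∈ Icc 0 T, GoodAt ε₀ K Y F t) {C₄ : ℝ} (hC₄ : 0 ≤ C₄)
    (hsmall : SmallModes K ε C₄ Y T) {ζ : ℝ}
    (hasym : ∀ t ∈ Icc 0 T, ∀ i : Fin 3, |W i (-1) t| ≤ ζ ∧ |W i 0 t| ≤ ζ ∧ |W i 1 t| ≤ ζ)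
    (hs : 16 * (K ^ 5 * (1 + ε₀) ^ (2 : ℝ)) * ((ε ^ 2)⁻¹ + ε⁻¹ * K ^ 10 + K + 1) * ζ ^ 2 ≤
      C₁ / 2 * (1 + ε₀) ^ (-(n₀ : ℝ) / 2)) :
    ZeroScale.Context ε₀ K ε C₁ C₂ C₃ C₄
        (C₂ * (1 + ε₀) ^ (2 : ℝ) * (cumEnergyConst ε₀ C₃ + 100) + C₁) n₀ N ηp βp τ Y W F T ζ ∧
      AsymWindow ε₀ K ε C₁ n₀ W T ζ :=
  ⟨h.zeroScale_context hε₀ hε₀1 hK hε hε1 hC₁ hC₂ hC₃ hN hT hgood hC₄ hsmall hasym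
      (asym_small_of_strong (by linarith) hε₀.le hε hs),
    asymWindow_of_bounds hasym hs⟩

end Context

end Tao2016AveragedNS

end Literature.Analysis.FluidPDE
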